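import Literature.MathematicalPhysics.QuantumFieldTheory.Balaban1983to89.B7Prop3GeneralLinearBound
import Literature.MathematicalPhysics.QuantumFieldTheory.Balaban1983to89.B7Prop5Flat

/-!
# `Balaban1983to89.B9B8KnitColumnFrameOneStep` — the (B)-line bond junction, file c4 (one step): [Balaban1985Averaging] (139) READ COLUMN BY COLUMN —
# the frame part of the one-step linearised covariant average `L(Q(V₀)A)_c − L·(Q₀A)_c` ((124)–(126)) applied to a SINGLE-BOND BUMP `X·δ_b` is
# `≤ 50(d+1)·ε·L·‖X‖` (`ε` the loop regularity `‖W_x(V₀) − 1‖ ≤ ε ≤ 1/8`), i.e. `≤ 800(d+1)²(d+4)L²α₀·L·‖X‖` under the plaquette regularity (109) —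
# print's «|Q″(V₀)A| ≤ C₁L²α₀Q″|A|, the constant C₁ depends on d and L» (p. 39) at the entry level

statement-level skeleton of published theorems with citation tags; proofs where landed; nothing here is a claim about the
Yang–Mills mass gap

Sub-row G-B8-T2S (unit `lit-balaban-t2s-1`, gen 7), RULING #10 road, crux (c′): the first brick of hypothesis (H1) of
`B9B8KnitAveragingClosenessWeighted.hQQ_of_columns` (design `lit-balaban-t2s-1/g7/BLINE-DESIGN-g7.md` §3(3a), §4).  The tree's
`B7Prop3GeneralLinearBound.norm_linQcov_sub_main_le` is the SUP-form of (126); on the bump field `A = X·δ_{(y,μ)}` (`sup|A| = ‖X‖`,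
`B7Prop5Flat.norm_bump_le`) it IS an entrywise statement about the column `X ↦ L(Q(V₀)(X·δ_b))_c` of the kernel — with an `L`-dependent constant,
exactly as print says.  Print: [5] (124)–(126) p. 36, (139)–(140) p. 39, (109) p. 34, (147) p. 40.

WHAT IS PROVED (kernel, 0 sorry; theorems only, no `def`, no `… : Prop` fact, no `instance`).
* ★★ `norm_linQcov_bump_sub_main_le` — `‖L(Q(V₀)(X·δ_b))_c − L·(Q₀(X·δ_b))_c‖ ≤ 50(d+1)·ε·L·‖X‖` for `V₀` with `‖V₀(b)‖, ‖V₀(b)⁻¹‖ ≤ 1` and block loops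
  `‖W_x(V₀) − 1‖ ≤ ε ≤ 1/8`.
* ★★ `norm_linQcov_bump_sub_main_le_of_plaquettes` — the same `≤ 800(d+1)²(d+4)L²α₀·L·‖X‖` from the plaquette regularity `‖V₀(∂p) − 1‖ ≤ α₀`
  (`512(d+1)(d+4)L²α₀ ≤ 1`, `16(d+1)(d+4)L²α₀ ≤ 1/8`; `B7Prop2Explicit.norm_Wcx_sub_one_le` BY NAME).

HONEST SCOPE.  One averaging step, one column; the iteration over levels, the main-term transport comparison and (H2)–(H3) are NOT here; count-neutral;
nothing continuum ∕ ℝ⁴ ∕ OS ∕ mass gap ∕ Clay — the Yang–Mills mass gap is NOT proved here.  NEW file; [5]'s files are used BY NAME, nothing landed is modified.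
-/

noncomputable section

namespace Literature.MathematicalPhysics.QuantumFieldTheory.Balaban1983to89.B9B8KnitColumnFrameOneStep

open scoped BigOperators
open B7Prop1Explicit
open B7Prop3GeneralLinear (linQcov Q0cov)
open B7Prop3GeneralLinearBound (norm_linQcov_sub_main_le)
open B7Prop5Flat (bump norm_bump_le)

variable {d : ℕ} {𝔸 : Type*} [NormedRing 𝔸] [NormedAlgebra ℂ 𝔸] [NormOneClass 𝔸] [CompleteSpace 𝔸] (L : ℕ)

/-- ★★ **(139) AT ONE COLUMN**: for a background `V₀` with `‖V₀(b)‖, ‖V₀(b)⁻¹‖ ≤ 1` whose block loops at the coarse bond `c = ⟨q, q + Le_κ⟩` satisfy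
`‖W_x(V₀) − 1‖ ≤ ε ≤ 1/8`, the frame part of the linearised average of a single-bond bump obeys
`‖L(Q(V₀)(X·δ_{(y,μ)}))_c − L·(Q₀(X·δ_{(y,μ)}))_c‖ ≤ 50(d+1)·ε·L·‖X‖`. [cite: Balaban1985Averaging, (124)–(126) p.36, (139)–(140) p.39] -/
theorem norm_linQcov_bump_sub_main_le {V₀ : B7Prop1Explicit.Site d → Fin d → 𝔸ˣ} (hV₀ : ∀ x κ, V₀ x κ ∈ U1 𝔸) (hL : 1 ≤ L) (q : B7Prop1Explicit.Site d) (κ : Fin d)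
    {ε : ℝ} (hε0 : 0 ≤ ε) (hε : ε ≤ 1 / 8) (hW : ∀ r : Fin d → Fin L, ‖((Wcx L V₀ q κ (boxVec L r) : 𝔸ˣ) : 𝔸) - 1‖ ≤ ε)
    (y : B7Prop1Explicit.Site d) (μ : Fin d) (X : 𝔸) :
    ‖linQcov L V₀ (bump y μ X) q κ - (L : ℝ) • Q0cov L V₀ (bump y μ X) q κ‖ ≤ 50 * (d + 1) * ε * L * ‖X‖ :=
  norm_linQcov_sub_main_le L hV₀ (norm_nonneg X) (fun x κ' => norm_bump_le y μ X x κ') hL q κ hε0 hε hW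

/-- ★★ **(139) AT ONE COLUMN FROM THE PLAQUETTE REGULARITY (109)**: if `‖V₀(∂p) − 1‖ ≤ α₀` at all plaquettes with `512(d+1)(d+4)L²α₀ ≤ 1` and
`16(d+1)(d+4)L²α₀ ≤ 1/8`, then `‖L(Q(V₀)(X·δ_b))_c − L·(Q₀(X·δ_b))_c‖ ≤ 800(d+1)²(d+4)L²α₀·L·‖X‖` — print's `C₁L²α₀` per entry with `C₁ = 800(d+1)²(d+4)·L`
(«C₁ depends on d and L»). [cite: Balaban1985Averaging, (139) p.39, (126) p.36, (109) p.34] -/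
theorem norm_linQcov_bump_sub_main_le_of_plaquettes {V₀ : B7Prop1Explicit.Site d → Fin d → 𝔸ˣ} (hV₀ : ∀ x κ, V₀ x κ ∈ U1 𝔸) (hL : 1 ≤ L) (q : B7Prop1Explicit.Site d) (κ : Fin d)
    {α₀ : ℝ} (hα₀ : 0 ≤ α₀) (hsmall : 512 * (d + 1) * (d + 4) * (L : ℝ) ^ 2 * α₀ ≤ 1)
    (hsmall' : 16 * (d + 1) * (d + 4) * (L : ℝ) ^ 2 * α₀ ≤ 1 / 8)
    (h44 : ∀ (x : B7Prop1Explicit.Site d) (κ κ' : Fin d), κ ≠ κ' → ‖((hol V₀ x (plaqWord κ κ') : 𝔸ˣ) : 𝔸) - 1‖ ≤ α₀)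
    (y : B7Prop1Explicit.Site d) (μ : Fin d) (X : 𝔸) :
    ‖linQcov L V₀ (bump y μ X) q κ - (L : ℝ) • Q0cov L V₀ (bump y μ X) q κ‖ ≤ 800 * (d + 1) ^ 2 * (d + 4) * (L : ℝ) ^ 2 * α₀ * L * ‖X‖ := by
  have hWε : ∀ r : Fin d → Fin L,
      ‖((Wcx L V₀ q κ (boxVec L r) : 𝔸ˣ) : 𝔸) - 1‖ ≤ 16 * (d + 1) * (d + 4) * (L : ℝ) ^ 2 * α₀ := fun r =>
    (B7Prop2Explicit.norm_Wcx_sub_one_le L hL V₀ hV₀ hα₀ hsmall h44 q κ r).trans (le_of_eq (by ring))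
  have h := norm_linQcov_bump_sub_main_le L hV₀ hL q κ (by positivity) hsmall' hWε y μ X
  refine h.trans (le_of_eq ?_)
  ring

end Literature.MathematicalPhysics.QuantumFieldTheory.Balaban1983to89.B9B8KnitColumnFrameOneStep
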